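import Literature.Computability.AlgebraicComplexity.StrassenPreorderHom
import HarnessLib

/-!
# Strassen duality for the abstract asymptotic rank: `R̃(a) = max_φ φ(a)` (Zuiddam 2018, Cor. 2.13; Strassen 1988, Thm. 3.8) — proved

Topic `Literature/Computability/AlgebraicComplexity`; fifth file of the abstract theory of asymptotic
spectra (see `StrassenPreorder.lean`). Everything here is proved.

## Content

* Properties of `R̃ = asympRankOf le` for a Strassen preorder: monotone, `R̃(x)^N ≤ R̃(x^N)`,
  `R̃(y^N) ≤ (R̃(y) + δ)^N` for every `δ > 0`, `R̃(n v) ≤ n R̃(v)`, `R̃(n) ≤ n`.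
* `asympRankOf_mono_of_asympLe` — if `R̃` is monotone for a relation `≼'` then it is monotone for its
  asymptotic preorder `≼'~` (so, iterating, for `⩽~`, `⩽~~`, `⩽~~~`).
* `exists_isSpectralPoint_le_pow` — if `p < R̃(a)^q` (`p, q ∈ ℕ`, `q ≥ 1`) then some spectral point has
  `p ≤ φ(a)^q`. Proof: the extension hypothesis of `exists_extension` for `⩽~` and the pair
  `(p, a^q)` holds, because a relation `m + 1 + s a^q ⩽~ m + s p` would give, by the cancellation
  laws 2.4(i),(ii), `a^q ⩽~~~ p` and hence `R̃(a)^q ≤ R̃(a^q) ≤ R̃(p) ≤ p`; then extend, maximalise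
  (Lemma 2.7) and take the homomorphism of Lemma 2.9. (This replaces Zuiddam's route through
  Lemma 2.11/Theorem 2.12, which needs Lemma 2.4(iii).)
* `exists_isSpectralPoint_eq_asympRankOf` — **Zuiddam Cor. 2.13 / Strassen 1988 Thm. 3.8 /
  CVZ 2023 Prop. 1.6 (abstract form)**: if `1 ⩽ a` (or `a ⩽ 0`) then some spectral point attains
  `φ(a) = R̃(a)`; together with `IsSpectralPoint.le_asympRankOf` this is `R̃(a) = max_{φ ∈ X} φ(a)`.
  The maximum is attained without topology: the relation
  `x ≼ y :⟺ ∃ δ > 0, ∀ φ ∈ X, φ(a) > R̃(a) - δ → φ(x) ≤ φ(y)` is a Strassen preorder containing `⩽`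
  and all pairs `(r, s a)` with `r/s < R̃(a)`; a spectral point of a maximal extension of it does it.

## References

* J. Zuiddam, PhD thesis (2018), §2.8, Cor. 2.13 (and Lemmas 2.4, 2.5, 2.7, 2.9). [Zuiddam2018]
* V. Strassen, J. reine angew. Math. 384 (1988), Thm. 3.8. [Strassen1988]
* M. Christandl, P. Vrana, J. Zuiddam, JAMS 36 (2023), Prop. 1.6. [ChristandlVranaZuiddam2023]
-/

noncomputable section

open scoped BigOperators

namespace Literature.Computability.AlgebraicComplexity

universe u

variable {S : Type u} [CommSemiring S]

namespace IsStrassenPreorder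

variable {le : S → S → Prop}

/-! ### Properties of the asymptotic rank -/

omit [CommSemiring S] in
/-- The terms `R(a^{N+1})^{1/(N+1)}` are bounded below by `0`. [folklore] -/
theorem bddBelow_range_rankOf_pow [CommSemiring S] (le : S → S → Prop) (a : S) :
    BddBelow (Set.range fun N : ℕ => ((rankOf le (a ^ (N + 1)) : ℝ) ^ ((N : ℝ) + 1)⁻¹)) :=
  ⟨0, by rintro _ ⟨N, rfl⟩; positivity⟩

omit [CommSemiring S] in
/-- `R̃(a) ≤ R(a^L)^{1/L}` for `L ≥ 1`. [cite: Zuiddam2018, §2.8] -/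
theorem asympRankOf_le_of_pos [CommSemiring S] (le : S → S → Prop) (a : S) {L : ℕ} (hL : 0 < L) :
    asympRankOf le a ≤ ((rankOf le (a ^ L)) : ℝ) ^ ((L : ℝ))⁻¹ := by
  obtain ⟨N, rfl⟩ : ∃ N, L = N + 1 := ⟨L - 1, (Nat.succ_pred_eq_of_pos hL).symm⟩
  have := asympRankOf_le le a N
  convert this using 2
  push_cast
  ring

/-- `R̃` is monotone. [cite: Zuiddam2018, §2.8] -/
theorem asympRankOf_mono (h : IsStrassenPreorder le) {x y : S} (hxy : le x y) :
    asympRankOf le x ≤ asympRankOf le y := by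
  unfold asympRankOf
  refine ciInf_mono (bddBelow_range_rankOf_pow le x) fun N => ?_
  exact Real.rpow_le_rpow (by positivity)
    (by exact_mod_cast h.rankOf_mono (h.pow_le_pow hxy _)) (by positivity)

omit [CommSemiring S] in
/-- `R̃(x)^N ≤ R̃(x^N)` for `N ≥ 1`. [cite: Zuiddam2018, §2.8] -/
theorem pow_asympRankOf_le [CommSemiring S] (le : S → S → Prop) (x : S) {N : ℕ} (hN : 1 ≤ N) :
    asympRankOf le x ^ N ≤ asympRankOf le (x ^ N) := by
  refine le_ciInf fun M => ?_
  have hL : 0 < N * (M + 1) := Nat.mul_pos (by omega) (Nat.succ_pos M)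
  have hρ := asympRankOf_le_of_pos le x hL
  have h0 : 0 ≤ asympRankOf le x := asympRankOf_nonneg le x
  have hN0 : (N : ℝ) ≠ 0 := by exact_mod_cast (by omega : N ≠ 0)
  calc asympRankOf le x ^ N
      ≤ (((rankOf le (x ^ (N * (M + 1))) : ℝ) ^ (((N * (M + 1) : ℕ) : ℝ))⁻¹)) ^ N :=
        pow_le_pow_left₀ h0 hρ N
    _ = ((rankOf le ((x ^ N) ^ (M + 1)) : ℝ) ^ ((M : ℝ) + 1)⁻¹) := by
        rw [← pow_mul, ← Real.rpow_natCast, ← Real.rpow_mul (by positivity)]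
        congr 1
        push_cast
        field_simp

/-- `R̃(y^N) ≤ (R̃(y) + δ)^N` for every `δ > 0` (via `R(y^{N L}) ≤ R(y^L)^N`). [cite: Zuiddam2018, §2.8] -/
theorem asympRankOf_pow_le (h : IsStrassenPreorder le) (y : S) (N : ℕ) {δ : ℝ} (hδ : 0 < δ) :
    asympRankOf le (y ^ N) ≤ (asympRankOf le y + δ) ^ N := by
  have hlt : asympRankOf le y < asympRankOf le y + δ := lt_add_of_pos_right _ hδ
  obtain ⟨M, hM⟩ := exists_lt_of_ciInf_lt hlt
  have h0 : 0 ≤ ((rankOf le (y ^ (M + 1)) : ℝ) ^ ((M : ℝ) + 1)⁻¹) := by positivity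
  calc asympRankOf le (y ^ N)
      ≤ ((rankOf le ((y ^ N) ^ (M + 1)) : ℝ) ^ ((M : ℝ) + 1)⁻¹) := asympRankOf_le le _ M
    _ ≤ (((rankOf le (y ^ (M + 1))) ^ N : ℕ) : ℝ) ^ ((M : ℝ) + 1)⁻¹ := by
        refine Real.rpow_le_rpow (by positivity) ?_ (by positivity)
        rw [← pow_mul, mul_comm, pow_mul]
        exact_mod_cast h.rankOf_pow_le (y ^ (M + 1)) N
    _ = (((rankOf le (y ^ (M + 1)) : ℝ) ^ ((M : ℝ) + 1)⁻¹)) ^ N := by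
        push_cast
        rw [← Real.rpow_natCast, ← Real.rpow_natCast, ← Real.rpow_mul (by positivity),
          ← Real.rpow_mul (by positivity), mul_comm]
    _ ≤ (asympRankOf le y + δ) ^ N := pow_le_pow_left₀ h0 hM.le N

/-- `R̃(0) = 0`. [cite: Zuiddam2018, §2.8] -/
theorem asympRankOf_zero (h : IsStrassenPreorder le) : asympRankOf le (0 : S) = 0 := by
  refine le_antisymm ?_ (asympRankOf_nonneg le 0)
  have := asympRankOf_le le (0 : S) 0
  have h0 : rankOf le ((0 : S) ^ (0 + 1)) = 0 := by
    rw [zero_add, pow_one, ← Nat.cast_zero, h.rankOf_natCast]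
  rw [h0] at this
  simpa using this

/-- `R̃(n) ≤ n` for naturals. [cite: Zuiddam2018, §2.8] -/
theorem asympRankOf_natCast_le (h : IsStrassenPreorder le) (n : ℕ) : asympRankOf le (n : S) ≤ n := by
  have := asympRankOf_le le (n : S) 0
  have h0 : rankOf le ((n : S) ^ (0 + 1)) = n := by rw [zero_add, pow_one, h.rankOf_natCast]
  rw [h0] at this
  simpa using this

/-- `R̃(n v) ≤ n R̃(v)`. [cite: Zuiddam2018, §2.8] -/
theorem asympRankOf_natCast_mul_le (h : IsStrassenPreorder le) (n : ℕ) (v : S) :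
    asympRankOf le ((n : S) * v) ≤ n * asympRankOf le v := by
  rcases Nat.eq_zero_or_pos n with rfl | hn
  · simp only [Nat.cast_zero, zero_mul, h.asympRankOf_zero, le_refl]
  have hn0 : (0 : ℝ) < n := by exact_mod_cast hn
  have key : ∀ M : ℕ, asympRankOf le ((n : S) * v) ≤
      n * ((rankOf le (v ^ (M + 1)) : ℝ) ^ ((M : ℝ) + 1)⁻¹) := by
    intro M
    have hc : ((M : ℝ) + 1)⁻¹ = (((M + 1 : ℕ) : ℝ))⁻¹ := by push_cast; ring
    calc asympRankOf le ((n : S) * v)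
        ≤ ((rankOf le (((n : S) * v) ^ (M + 1)) : ℝ) ^ ((M : ℝ) + 1)⁻¹) := asympRankOf_le le _ M
      _ ≤ (((n ^ (M + 1) * rankOf le (v ^ (M + 1)) : ℕ)) : ℝ) ^ ((M : ℝ) + 1)⁻¹ := by
          refine Real.rpow_le_rpow (by positivity) ?_ (by positivity)
          rw [mul_pow, ← Nat.cast_pow]
          exact_mod_cast h.rankOf_natCast_mul_le (n ^ (M + 1)) (v ^ (M + 1))
      _ = n * ((rankOf le (v ^ (M + 1)) : ℝ) ^ ((M : ℝ) + 1)⁻¹) := by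
          push_cast
          rw [Real.mul_rpow (by positivity) (by positivity), hc,
            Real.pow_rpow_inv_natCast hn0.le (Nat.succ_ne_zero M)]
  have : asympRankOf le ((n : S) * v) / n ≤ asympRankOf le v := by
    refine le_ciInf fun M => ?_
    rw [div_le_iff₀ hn0]
    exact (key M).trans_eq (mul_comm _ _)
  rw [div_le_iff₀ hn0] at this
  linarith

/-- If `R̃` is monotone for a relation `≼'`, then it is monotone for the asymptotic preorder `≼'~`
(`R̃(x)^N ≤ R̃(x^N) ≤ f(N) R̃(y^N) ≤ f(N) (R̃(y) + δ)^N` with `f` subexponential). [cite: Zuiddam2018, Cor. 2.13] -/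
theorem asympRankOf_mono_of_asympLe (h : IsStrassenPreorder le) {le' : S → S → Prop}
    (hmono : ∀ x y, le' x y → asympRankOf le x ≤ asympRankOf le y) {x y : S}
    (hxy : AsympLe le' x y) : asympRankOf le x ≤ asympRankOf le y := by
  obtain ⟨f, hf, hN⟩ := hxy
  refine le_of_forall_pos_lt_add fun δ hδ => ?_
  have hy0 := asympRankOf_nonneg le y
  have key : asympRankOf le x ≤ asympRankOf le y + δ / 2 := by
    refine hf.le_of_pow_le (by positivity) fun N hN1 => ?_
    calc asympRankOf le x ^ N ≤ asympRankOf le (x ^ N) := pow_asympRankOf_le le x hN1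
      _ ≤ asympRankOf le ((f N : S) * y ^ N) := hmono _ _ (hN N)
      _ ≤ f N * asympRankOf le (y ^ N) := h.asympRankOf_natCast_mul_le _ _
      _ ≤ f N * (asympRankOf le y + δ / 2) ^ N :=
          mul_le_mul_of_nonneg_left (h.asympRankOf_pow_le y N (half_pos hδ)) (by positivity)
  linarith

/-! ### Spectral points with large value at `a` -/

/-- If `p < R̃(a)^q` (`q ≥ 1`) then some spectral point satisfies `p ≤ φ(a)^q`. See the module
docstring for the proof (extension lemma for `⩽~` and `(p, a^q)`, maximal extension, Lemma 2.9).
[cite: Zuiddam2018, Cor. 2.13] -/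
theorem exists_isSpectralPoint_le_pow (h : IsStrassenPreorder le) (a : S) {p q : ℕ} (hq : 1 ≤ q)
    (hp : (p : ℝ) < asympRankOf le a ^ q) :
    ∃ φ : S → ℝ, IsSpectralPoint le φ ∧ (p : ℝ) ≤ φ a ^ q := by
  have h₁ := h.asympLe
  have h₂ := h₁.asympLe
  have m₀ : ∀ x y, le x y → asympRankOf le x ≤ asympRankOf le y :=
    fun x y hxy => h.asympRankOf_mono hxy
  have m₁ : ∀ x y, AsympLe le x y → asympRankOf le x ≤ asympRankOf le y :=
    fun x y hxy => h.asympRankOf_mono_of_asympLe m₀ hxy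
  have m₂ : ∀ x y, AsympLe (AsympLe le) x y → asympRankOf le x ≤ asympRankOf le y :=
    fun x y hxy => h.asympRankOf_mono_of_asympLe m₁ hxy
  have m₃ : ∀ x y, AsympLe (AsympLe (AsympLe le)) x y → asympRankOf le x ≤ asympRankOf le y :=
    fun x y hxy => h.asympRankOf_mono_of_asympLe m₂ hxy
  have H : ∀ (s : S) (m : ℕ),
      ¬ AsympLe le ((m : S) + 1 + s * a ^ q) ((m : S) + s * (p : S)) := by
    intro s m hsm
    have e1 : (m : S) + 1 + s * a ^ q = (1 + s * a ^ q) + m := by ring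
    have e2 : (m : S) + s * (p : S) = s * (p : S) + m := by ring
    rw [e1, e2] at hsm
    have c1 : AsympLe (AsympLe le) (1 + s * a ^ q) (s * (p : S)) := h₁.asympLe_of_add_le hsm
    have c2 : AsympLe (AsympLe le) (s * a ^ q) (s * (p : S)) :=
      h₂.trans (h₂.le_add_left _ _) c1
    by_cases hs : s = 0
    · subst hs
      have h10 : AsympLe (AsympLe le) ((1 : ℕ) : S) ((0 : ℕ) : S) := by simpa using c1
      have := (h₂.natCast_le_iff 1 0).1 h10
      omega
    · have c3 : AsympLe (AsympLe (AsympLe le)) (a ^ q) (p : S) := by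
        refine h₂.asympLe_of_mul_le hs ?_
        rwa [mul_comm (a ^ q) s, mul_comm (p : S) s]
      have c4 := m₃ _ _ c3
      have c5 := h.asympRankOf_natCast_le p
      have c6 := pow_asympRankOf_le le a hq
      linarith
  obtain ⟨le', h', hle', hpa⟩ := h₁.exists_extension H
  obtain ⟨φ, hφ, hφ'⟩ :=
    h.exists_isSpectralPoint_of_imp h' fun x y hxy => hle' x y (h.asympLe_of_le hxy)
  refine ⟨φ, hφ, ?_⟩
  have := hφ'.mono hpa
  rwa [hφ'.map_natCast, hφ'.map_pow] at this

omit [CommSemiring S] in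
/-- Between `1 ≤ x < y` there is a number of the form `p^{1/q}`: `x^q < p < y^q` for some
`p, q ∈ ℕ`, `q ≥ 1` (since `y^q ≥ x^q + q (y - x)`). [folklore] -/
theorem exists_nat_pow_btwn {x y : ℝ} (hx : 1 ≤ x) (hxy : x < y) :
    ∃ p q : ℕ, 1 ≤ q ∧ x ^ q < p ∧ (p : ℝ) < y ^ q := by
  obtain ⟨q, hq⟩ := exists_nat_gt (1 / (y - x))
  have hyx : 0 < y - x := by linarith
  have hq1 : 1 < (q : ℝ) * (y - x) := by rwa [div_lt_iff₀ hyx] at hq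
  have hqpos : 1 ≤ q := by
    rcases Nat.eq_zero_or_pos q with rfl | h0
    · norm_num at hq1
    · exact h0
  have key : ∀ n : ℕ, x ^ n + n * (y - x) ≤ y ^ n := by
    intro n
    induction n with
    | zero => simp
    | succ n ih =>
      have hxn : 1 ≤ x ^ n := one_le_pow₀ hx
      have hn0 : (0 : ℝ) ≤ n * (y - x) := by positivity
      push_cast
      rw [pow_succ, pow_succ]
      nlinarith
  refine ⟨⌊x ^ q⌋₊ + 1, q, hqpos, ?_, ?_⟩
  · push_cast
    exact Nat.lt_floor_add_one _
  · calc (((⌊x ^ q⌋₊ + 1 : ℕ)) : ℝ) ≤ x ^ q + 1 := by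
          push_cast
          linarith [Nat.floor_le (by positivity : 0 ≤ x ^ q)]
      _ < x ^ q + q * (y - x) := by linarith
      _ ≤ y ^ q := key q

/-- **Strassen duality for the abstract asymptotic rank** (Zuiddam 2018, Cor. 2.13; Strassen 1988,
Thm. 3.8; CVZ 2023, Prop. 1.6): if `1 ⩽ a` then some spectral point attains `φ(a) = R̃(a)` (and every
spectral point has `φ(a) ≤ R̃(a)`, `IsSpectralPoint.le_asympRankOf`), i.e. `R̃(a) = max_{φ ∈ X} φ(a)`. [cite: Zuiddam2018, Cor. 2.13] -/
theorem exists_isSpectralPoint_eq_asympRankOf (h : IsStrassenPreorder le) (a : S) (ha : le 1 a) :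
    ∃ φ : S → ℝ, IsSpectralPoint le φ ∧ φ a = asympRankOf le a := by
  set ρ : ℝ := asympRankOf le a with hρ
  have hρ1 : 1 ≤ ρ := by
    refine le_ciInf fun N => ?_
    have h1 : (1 : ℝ) ≤ rankOf le (a ^ (N + 1)) := by
      have := h.rankOf_mono (h.pow_le_pow ha (N + 1))
      rw [one_pow, ← Nat.cast_one, h.rankOf_natCast] at this
      exact_mod_cast this
    calc (1 : ℝ) = 1 ^ ((N : ℝ) + 1)⁻¹ := (Real.one_rpow _).symm
      _ ≤ _ := Real.rpow_le_rpow _root_.zero_le_one h1 (by positivity)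
  -- Claim: spectral points with value at `a` arbitrarily close to `ρ`
  have claim : ∀ δ : ℝ, 0 < δ → ∃ φ : S → ℝ, IsSpectralPoint le φ ∧ ρ - δ < φ a := by
    intro δ hδ
    by_cases hsmall : ρ - δ < 1
    · obtain ⟨φ, hφ⟩ := h.exists_isSpectralPoint
      refine ⟨φ, hφ, lt_of_lt_of_le hsmall ?_⟩
      simpa [hφ.map_one] using hφ.mono ha
    · rw [not_lt] at hsmall
      obtain ⟨p, q, hq, hxq, hpy⟩ := exists_nat_pow_btwn (y := ρ) hsmall (by linarith)
      obtain ⟨φ, hφ, hpφ⟩ := h.exists_isSpectralPoint_le_pow a hq hpy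
      refine ⟨φ, hφ, ?_⟩
      by_contra hle
      rw [not_lt] at hle
      have h0 : 0 ≤ φ a := hφ.nonneg h a
      have : φ a ^ q ≤ (ρ - δ) ^ q := pow_le_pow_left₀ h0 hle q
      linarith
  -- the eventual preorder
  set lev : S → S → Prop := fun x y => ∃ δ : ℝ, 0 < δ ∧
    ∀ φ : S → ℝ, IsSpectralPoint le φ → ρ - δ < φ a → φ x ≤ φ y with hlev
  have hev : IsStrassenPreorder lev :=
    { refl := fun x => ⟨1, one_pos, fun φ _ _ => le_rfl⟩
      trans := by
        rintro x y z ⟨δ₁, hδ₁, H₁⟩ ⟨δ₂, hδ₂, H₂⟩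
        refine ⟨min δ₁ δ₂, lt_min hδ₁ hδ₂, fun φ hφ hlt => (H₁ φ hφ ?_).trans (H₂ φ hφ ?_)⟩
        · exact lt_of_le_of_lt (by linarith [min_le_left δ₁ δ₂]) hlt
        · exact lt_of_le_of_lt (by linarith [min_le_right δ₁ δ₂]) hlt
      natCast_le_iff := by
        intro n m
        constructor
        · rintro ⟨δ, hδ, H⟩
          obtain ⟨φ, hφ, hlt⟩ := claim δ hδ
          have := H φ hφ hlt
          rw [hφ.map_natCast, hφ.map_natCast] at this
          exact_mod_cast this
        · intro hnm
          refine ⟨1, one_pos, fun φ hφ _ => ?_⟩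
          rw [hφ.map_natCast, hφ.map_natCast]
          exact_mod_cast hnm
      add_right := by
        rintro x y c ⟨δ, hδ, H⟩
        refine ⟨δ, hδ, fun φ hφ hlt => ?_⟩
        rw [hφ.map_add, hφ.map_add]
        linarith [H φ hφ hlt]
      mul_right := by
        rintro x y c ⟨δ, hδ, H⟩
        refine ⟨δ, hδ, fun φ hφ hlt => ?_⟩
        rw [hφ.map_mul, hφ.map_mul]
        exact mul_le_mul_of_nonneg_right (H φ hφ hlt) (hφ.nonneg h c)
      exists_le_natCast_mul := by
        intro x b hb
        obtain ⟨r, hr⟩ := h.exists_le_natCast_mul x hb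
        exact ⟨r, 1, one_pos, fun φ hφ _ => hφ.mono hr⟩ }
  have hle_ev : ∀ x y, le x y → lev x y := fun x y hxy => ⟨1, one_pos, fun φ hφ _ => hφ.mono hxy⟩
  have hfrac : ∀ r s : ℕ, 0 < s → (r : ℝ) / s < ρ → lev (r : S) ((s : S) * a) := by
    intro r s hs hrs
    refine ⟨ρ - r / s, by linarith, fun φ hφ hlt => ?_⟩
    rw [hφ.map_natCast, hφ.map_mul, hφ.map_natCast]
    have h1 : (r : ℝ) / s < φ a := by linarith
    rw [div_lt_iff₀ (by exact_mod_cast hs)] at h1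
    linarith
  obtain ⟨φ, hφ, hφev⟩ := h.exists_isSpectralPoint_of_imp hev hle_ev
  refine ⟨φ, hφ, le_antisymm (hφ.le_asympRankOf h a) ?_⟩
  by_contra hlt
  rw [not_le] at hlt
  have h0 : 0 ≤ φ a := hφ.nonneg h a
  obtain ⟨s, hs⟩ := exists_nat_gt (1 / (ρ - φ a))
  have hgap : 0 < ρ - φ a := by linarith
  have hs0 : (0 : ℝ) < s := lt_trans (by positivity) hs
  have hspos : 0 < s := by exact_mod_cast hs0
  have hs1 : 1 < (s : ℝ) * (ρ - φ a) := by rwa [div_lt_iff₀ hgap] at hs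
  set r : ℕ := ⌊(s : ℝ) * φ a⌋₊ + 1 with hr
  have hr1 : (s : ℝ) * φ a < r := by
    rw [hr]; push_cast; exact Nat.lt_floor_add_one _
  have hr2 : (r : ℝ) ≤ s * φ a + 1 := by
    rw [hr]; push_cast; linarith [Nat.floor_le (by positivity : 0 ≤ (s : ℝ) * φ a)]
  have hrs : (r : ℝ) / s < ρ := by
    rw [div_lt_iff₀ hs0]
    nlinarith
  have := hφev.mono (hfrac r s hspos hrs)
  rw [hφev.map_natCast, hφev.map_mul, hφev.map_natCast] at this
  linarith

/-- The degenerate case: if `a ⩽ 0` then `R̃(a) = 0 = φ(a)` for every spectral point, and spectral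
points exist. [cite: Zuiddam2018, Cor. 2.13] -/
theorem exists_isSpectralPoint_eq_asympRankOf_of_le_zero (h : IsStrassenPreorder le) (a : S)
    (ha : le a 0) : ∃ φ : S → ℝ, IsSpectralPoint le φ ∧ φ a = asympRankOf le a := by
  obtain ⟨φ, hφ⟩ := h.exists_isSpectralPoint
  have hρ : asympRankOf le a = 0 := by
    refine le_antisymm ?_ (asympRankOf_nonneg le a)
    have := asympRankOf_le le a 0
    have h0 : rankOf le (a ^ (0 + 1)) = 0 := by
      rw [zero_add, pow_one, h.rankOf_eq_zero_iff]
      exact ha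
    rw [h0] at this
    simpa using this
  refine ⟨φ, hφ, ?_⟩
  rw [hρ]
  exact le_antisymm (by simpa [hφ.map_zero] using hφ.mono ha) (hφ.nonneg h a)

end IsStrassenPreorder

end Literature.Computability.AlgebraicComplexity

end
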